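import Literature.RingTheory.Flat.IsomorphismModuloNilpotentRelative
import Literature.AlgebraicGeometry.Morphisms.EtaleLiftDualNumber
import Mathlib.AlgebraicGeometry.Morphisms.Flat
import Mathlib.AlgebraicGeometry.Morphisms.ClosedImmersion
import Mathlib.AlgebraicGeometry.Morphisms.IsIso
import HarnessLib

/-!
# A morphism over a nilpotent thickening of the base is an isomorphism if it is one modulo the ideal

Topic `Literature/AlgebraicGeometry/Morphisms`; theorems only (no definition, no named fact, no
instance). The scheme-theoretic form of Schlessinger's Lemma 3.3 ([Schlessinger1968] p. 216;
ring form `Literature.RingTheory.Flat.bijective_of_isPushout_of_isNilpotent_ker`): let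
`g : S₀ ⟶ S` be a morphism of AFFINE schemes whose map on global sections is surjective with
nilpotent kernel (`Spec (R/J) ⟶ Spec R` for `J` nilpotent, `Spec k ⟶ Spec k[ε]`, the closed
point of an Artinian local ring), and let
```
P₀ --iP--> P
|f₀        |f
v          v
Q₀ --iQ--> Q
|q₀        |q
v          v
S₀ --g---> S
```
be two cartesian squares. If `P` is flat over `S` (`f ≫ q` flat) and the base change `f₀` is an
isomorphism, then `f` is an isomorphism.

Proof: `g`, hence `iQ` and `iP`, are surjective closed immersions, so homeomorphisms; with `f₀`
a homeomorphism, `f` is one, hence an affine morphism (Mathlib `isAffineHom_of_isInducing`).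
Being an isomorphism is local on the target; over an affine open `U ⊆ Q` the section rings of
`U`, `f⁻¹U`, `iQ⁻¹U`, `iP⁻¹f⁻¹U` form two pushout squares (Mathlib
`isIso_pushoutSection_of_isAffineOpen`), and the ring form applies.

* `isIso_of_isIso_of_isPullback_of_surjective_appTop` — the statement above;
* `isIso_of_isIso_of_isPullback_specMap` — base `Spec.map ρ`, `ρ` surjective with nilpotent kernel;
* `isIso_of_isIso_of_isPullback_specMap_dualNumber_fst` — `Spec k ⟶ Spec k[ε]`.

## References
* [Schlessinger1968] M. Schlessinger, *Functors of Artin rings*, Trans. AMS 130 (1968), Lemma 3.3,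
  p. 216.
* [GortzWedhorn2020] U. Görtz, T. Wedhorn, *Algebraic Geometry I*, 2nd ed., Cor. 2.11 and
  Prop. 2.12 (`Spec` of a quotient is a homeomorphism onto `V(𝔞)`), for the topological step.
-/

noncomputable section

open CategoryTheory CategoryTheory.Limits AlgebraicGeometry Topology

universe u

namespace Literature.AlgebraicGeometry.Morphisms

/-! ## §1 Affine thickenings of the base -/

section Affine

variable {S S₀ P Q P₀ Q₀ : Scheme.{u}} [IsAffine S] [IsAffine S₀] {g : S₀ ⟶ S}
  {f : P ⟶ Q} {q : Q ⟶ S} {iQ : Q₀ ⟶ Q} {q₀ : Q₀ ⟶ S₀} {f₀ : P₀ ⟶ Q₀} {iP : P₀ ⟶ P}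

/-- A morphism of affine schemes which is surjective on global sections with nil kernel is a
surjective closed immersion. [cite: GortzWedhorn2020, Cor. 2.11 and Prop. 2.12 (1)] -/
theorem isClosedImmersion_and_surjective_of_surjective_appTop (g : S₀ ⟶ S)
    (hg : Function.Surjective g.appTop.hom) (hnil : RingHom.ker g.appTop.hom ≤ nilradical _) :
    IsClosedImmersion g ∧ Surjective g := by
  refine ⟨(HasAffineProperty.iff_of_isAffine (P := @IsClosedImmersion)).mpr ⟨‹_›, hg⟩, ?_⟩
  have hS : Surjective (Spec.map g.appTop) := surjective_specMap_of_ker_le_nilradical _ hg hnil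
  have heq : g = S₀.isoSpec.hom ≫ Spec.map g.appTop ≫ S.isoSpec.inv := by
    rw [← Category.assoc, Scheme.isoSpec_hom_naturality, Category.assoc, Iso.hom_inv_id,
      Category.comp_id]
  rw [heq]
  infer_instance

/-- **An isomorphism modulo a nilpotent thickening of an affine base is an isomorphism**
(Schlessinger's Lemma 3.3, chart by chart). Let `g : S₀ ⟶ S` be a morphism of affine schemes
with `Γ(g)` surjective with nilpotent kernel, `q : Q ⟶ S`, `f : P ⟶ Q`, and cartesian squares
`hQ : IsPullback iQ q₀ q g`, `hP : IsPullback iP f₀ f iQ`. If `f ≫ q` is flat (`P` flat over `S`)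
and `f₀` is an isomorphism, then `f` is an isomorphism. [cite: Schlessinger1968, Lemma 3.3,
p. 216] -/
theorem isIso_of_isIso_of_isPullback_of_surjective_appTop
    (hg : Function.Surjective g.appTop.hom) (hnil : IsNilpotent (RingHom.ker g.appTop.hom))
    (hQ : IsPullback iQ q₀ q g) (hP : IsPullback iP f₀ f iQ) [Flat (f ≫ q)] [IsIso f₀] :
    IsIso f := by
  -- `g`, `iQ`, `iP` are surjective closed immersions
  obtain ⟨hg₁, hg₂⟩ := isClosedImmersion_and_surjective_of_surjective_appTop g hg
    (le_nilradical_of_isNilpotent hnil)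
  haveI : IsClosedImmersion iQ := MorphismProperty.of_isPullback hQ.flip hg₁
  haveI : Surjective iQ := MorphismProperty.of_isPullback hQ.flip hg₂
  haveI : IsClosedImmersion iP := MorphismProperty.of_isPullback hP.flip ‹IsClosedImmersion iQ›
  haveI : Surjective iP := MorphismProperty.of_isPullback hP.flip ‹Surjective iQ›
  haveI : IsAffineHom iQ := inferInstance
  haveI : IsAffineHom iP := inferInstance
  -- hence homeomorphisms, and `f = iQ ∘ f₀ ∘ iP⁻¹` is a homeomorphism
  let eQ : ↥Q₀ ≃ₜ ↥Q := iQ.isClosedEmbedding.isEmbedding.toHomeomorphOfSurjective iQ.surjective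
  let eP : ↥P₀ ≃ₜ ↥P := iP.isClosedEmbedding.isEmbedding.toHomeomorphOfSurjective iP.surjective
  let e₀ : ↥P₀ ≃ₜ ↥Q₀ := f₀.homeomorph
  let e : ↥P ≃ₜ ↥Q := eP.symm.trans (e₀.trans eQ)
  have he : ⇑e = ⇑f := by
    funext x
    obtain ⟨y, rfl⟩ := eP.surjective x
    change eQ (e₀ (eP.symm (eP y))) = f (eP y)
    rw [eP.symm_apply_apply]
    change iQ (f₀ y) = f (iP y)
    rw [← Scheme.Hom.comp_apply, ← Scheme.Hom.comp_apply, hP.w]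
  haveI : IsAffineHom f := by
    refine isAffineHom_of_isInducing f ?_ ?_
    · rw [← he]; exact e.isInducing
    · rw [← he, e.surjective.range_eq]; exact isClosed_univ
  -- being an isomorphism is local on the target: test over affine opens `U ⊆ Q`
  rw [← MorphismProperty.isomorphisms.iff]
  refine IsZariskiLocalAtTarget.of_iSup_eq_top (P := MorphismProperty.isomorphisms Scheme)
    (fun U : Q.affineOpens => (U : Q.Opens)) (iSup_affineOpens_eq_top Q) fun U => ?_
  haveI : IsAffine (U : Q.Opens) := U.2
  have hV : IsAffineOpen (f ⁻¹ᵁ (U : Q.Opens)) := U.2.preimage f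
  haveI : IsAffine (f ⁻¹ᵁ (U : Q.Opens)) := hV
  rw [HasAffineProperty.iff_of_isAffine (P := MorphismProperty.isomorphisms Scheme)]
  refine ⟨hV, ?_⟩
  -- the chart map `Γ(Q, U) → Γ(P, f⁻¹U)` is bijective
  have hU₀ : IsAffineOpen (iQ ⁻¹ᵁ (U : Q.Opens)) := U.2.preimage iQ
  have hV₀ : IsAffineOpen (iP ⁻¹ᵁ (f ⁻¹ᵁ (U : Q.Opens))) := hV.preimage iP
  have hVeq : iP ⁻¹ᵁ (f ⁻¹ᵁ (U : Q.Opens)) = f₀ ⁻¹ᵁ (iQ ⁻¹ᵁ (U : Q.Opens)) := by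
    rw [← Scheme.Hom.comp_preimage, hP.w, Scheme.Hom.comp_preimage]
  have e₀' : iP ⁻¹ᵁ (f ⁻¹ᵁ (U : Q.Opens)) ≤ f₀ ⁻¹ᵁ (iQ ⁻¹ᵁ (U : Q.Opens)) := hVeq.le
  have hUY₁ : iQ ⁻¹ᵁ (U : Q.Opens) = iQ ⁻¹ᵁ (U : Q.Opens) ⊓ q₀ ⁻¹ᵁ ⊤ := by simp
  have T₁ : IsPushout (q.appLE ⊤ U le_top) (g.appLE ⊤ ⊤ le_top)
      (iQ.appLE U (iQ ⁻¹ᵁ (U : Q.Opens)) le_rfl) (q₀.appLE ⊤ (iQ ⁻¹ᵁ (U : Q.Opens)) le_top) := by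
    have hiso := isIso_pushoutSection_of_isAffineOpen hQ (le_top : (⊤ : S₀.Opens) ≤ g ⁻¹ᵁ ⊤)
      (le_top : (U : Q.Opens) ≤ q ⁻¹ᵁ ⊤) hUY₁ (isAffineOpen_top S) (isAffineOpen_top S₀) U.2
    exact (isIso_pushoutSection_iff hQ _ _ hUY₁).mp hiso
  have hUY₂ : iP ⁻¹ᵁ (f ⁻¹ᵁ (U : Q.Opens)) =
      iP ⁻¹ᵁ (f ⁻¹ᵁ (U : Q.Opens)) ⊓ f₀ ⁻¹ᵁ (iQ ⁻¹ᵁ (U : Q.Opens)) :=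
    (inf_eq_left.mpr e₀').symm
  have T₂ : IsPushout (f.appLE U (f ⁻¹ᵁ (U : Q.Opens)) le_rfl)
      (iQ.appLE U (iQ ⁻¹ᵁ (U : Q.Opens)) le_rfl)
      (iP.appLE (f ⁻¹ᵁ (U : Q.Opens)) (iP ⁻¹ᵁ (f ⁻¹ᵁ (U : Q.Opens))) le_rfl)
      (f₀.appLE (iQ ⁻¹ᵁ (U : Q.Opens)) (iP ⁻¹ᵁ (f ⁻¹ᵁ (U : Q.Opens))) e₀') := by
    have hiso := isIso_pushoutSection_of_isAffineOpen hP
      (le_rfl : iQ ⁻¹ᵁ (U : Q.Opens) ≤ iQ ⁻¹ᵁ (U : Q.Opens))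
      (le_rfl : f ⁻¹ᵁ (U : Q.Opens) ≤ f ⁻¹ᵁ (U : Q.Opens)) hUY₂ U.2 hU₀ hV
    exact (isIso_pushoutSection_iff hP _ _ hUY₂).mp hiso
  have hRB : (q.appLE ⊤ U le_top ≫ f.appLE U (f ⁻¹ᵁ (U : Q.Opens)) le_rfl).hom.Flat := by
    rw [Scheme.Hom.appLE_comp_appLE]
    exact HasRingHomProperty.appLE @Flat (f ≫ q) ‹_› ⟨⊤, isAffineOpen_top S⟩ ⟨_, hV⟩ _
  -- `f₀.appLE (iQ⁻¹U) (f₀⁻¹(iQ⁻¹U)) = f₀.app (iQ⁻¹U)` is an isomorphism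
  have hφ₀ : Function.Bijective
      (f₀.appLE (iQ ⁻¹ᵁ (U : Q.Opens)) (iP ⁻¹ᵁ (f ⁻¹ᵁ (U : Q.Opens))) e₀').hom := by
    rw [Scheme.Hom.appLE_congr f₀ e₀' rfl hVeq (fun φ => Function.Bijective φ.hom),
      Scheme.Hom.appLE_eq_app]
    exact (ConcreteCategory.isIso_iff_bijective _).mp inferInstance
  have hg₁' : Function.Surjective (g.appLE ⊤ ⊤ le_top).hom := by
    rw [Scheme.Hom.appTop, Scheme.Hom.app_eq_appLE] at hg; exact hg
  have hnil' : IsNilpotent (RingHom.ker (g.appLE ⊤ ⊤ le_top).hom) := by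
    rw [Scheme.Hom.appTop, Scheme.Hom.app_eq_appLE] at hnil; exact hnil
  have hbij := Literature.RingTheory.Flat.bijective_of_isPushout_of_isNilpotent_ker hg₁' hnil'
    T₁ T₂ hRB hφ₀
  -- hence `(f ∣_ U).appTop` is an isomorphism
  haveI : IsIso (f.appLE U (f ⁻¹ᵁ (U : Q.Opens)) le_rfl) :=
    (ConcreteCategory.isIso_iff_bijective _).mpr hbij
  rw [← Scheme.Hom.resLE_eq_morphismRestrict, Scheme.Hom.appTop, Scheme.Hom.resLE_app_top]
  infer_instance

end Affine

/-! ## §2 `Spec` bases -/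

section SpecBase

variable {R R₀ : CommRingCat.{u}} {P Q P₀ Q₀ : Scheme.{u}} {f : P ⟶ Q} {q : Q ⟶ Spec R}
  {iQ : Q₀ ⟶ Q} {q₀ : Q₀ ⟶ Spec R₀} {f₀ : P₀ ⟶ Q₀} {iP : P₀ ⟶ P}

/-- `Γ(Spec ρ)` is `ρ` conjugated by the canonical isomorphisms `Γ(Spec R) ≅ R`. [folklore] -/
private theorem appTop_specMap_eq' (ρ : R ⟶ R₀) :
    (Spec.map ρ).appTop = (Scheme.ΓSpecIso R).hom ≫ ρ ≫ (Scheme.ΓSpecIso R₀).inv := by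
  rw [← Category.assoc, ← Scheme.ΓSpecIso_naturality, Category.assoc, Iso.hom_inv_id,
    Category.comp_id]

/-- Surjectivity and kernel nilpotence pass from `ρ` to `Γ(Spec ρ)`. [folklore] -/
private theorem appTop_specMap_surjective_ker' (ρ : R ⟶ R₀) (hρ : Function.Surjective ρ.hom)
    (hnil : IsNilpotent (RingHom.ker ρ.hom)) :
    Function.Surjective (Spec.map ρ).appTop.hom ∧
      IsNilpotent (RingHom.ker (Spec.map ρ).appTop.hom) := by
  let e₁ : Γ(Spec R, ⊤) ≃+* R := (Scheme.ΓSpecIso R).commRingCatIsoToRingEquiv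
  let e₂ : R₀ ≃+* Γ(Spec R₀, ⊤) := (Scheme.ΓSpecIso R₀).symm.commRingCatIsoToRingEquiv
  have heq : ∀ x, (Spec.map ρ).appTop.hom x = e₂ (ρ.hom (e₁ x)) := fun x =>
    congrArg (fun φ : Γ(Spec R, ⊤) ⟶ Γ(Spec R₀, ⊤) => φ.hom x) (appTop_specMap_eq' ρ)
  have hker : RingHom.ker (Spec.map ρ).appTop.hom = (RingHom.ker ρ.hom).map e₁.symm := by
    rw [Ideal.map_symm]
    ext x
    simp only [RingHom.mem_ker, Ideal.mem_comap, heq, map_eq_zero_iff _ e₂.injective]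
  refine ⟨?_, ?_⟩
  · intro y
    obtain ⟨r, hr⟩ := hρ (e₂.symm y)
    exact ⟨e₁.symm r, by rw [heq, RingEquiv.apply_symm_apply, hr, RingEquiv.apply_symm_apply]⟩
  · rw [hker]
    obtain ⟨n, hn⟩ := hnil
    exact ⟨n, by rw [← Ideal.map_pow, hn, Ideal.zero_eq_bot, Ideal.map_bot, Submodule.zero_eq_bot]⟩

/-- **An isomorphism modulo a nilpotent ideal of the base ring is an isomorphism.** Let
`ρ : R ⟶ R₀` be surjective with nilpotent kernel, `q : Q ⟶ Spec R`, `f : P ⟶ Q`,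
`hQ : IsPullback iQ q₀ q (Spec.map ρ)`, `hP : IsPullback iP f₀ f iQ`. If `P` is flat over `R` and
`f ⊗_R R₀` is an isomorphism, then `f` is an isomorphism. [cite: Schlessinger1968, Lemma 3.3,
p. 216] -/
theorem isIso_of_isIso_of_isPullback_specMap (ρ : R ⟶ R₀) (hρ : Function.Surjective ρ.hom)
    (hnil : IsNilpotent (RingHom.ker ρ.hom)) (hQ : IsPullback iQ q₀ q (Spec.map ρ))
    (hP : IsPullback iP f₀ f iQ) [Flat (f ≫ q)] [IsIso f₀] : IsIso f := by
  obtain ⟨h₁, h₂⟩ := appTop_specMap_surjective_ker' ρ hρ hnil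
  exact isIso_of_isIso_of_isPullback_of_surjective_appTop h₁ h₂ hQ hP

/-- **First-order deformations: a morphism of flat `k[ε]`-schemes which is an isomorphism
modulo `ε` is an isomorphism.** With `Spec k ⟶ Spec k[ε]` along `TrivSqZeroExt.fst` (kernel
`(ε)`, `ε² = 0`): if `P` is flat over `k[ε]` and `f ⊗_{k[ε]} k` is an isomorphism then `f` is an
isomorphism. [cite: Schlessinger1968, Lemma 3.3, p. 216] -/
theorem isIso_of_isIso_of_isPullback_specMap_dualNumber_fst {k : Type u} [CommRing k]
    {q : Q ⟶ Spec (.of (DualNumber k))} {q₀ : Q₀ ⟶ Spec (.of k)}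
    (hQ : IsPullback iQ q₀ q
      (Spec.map (CommRingCat.ofHom (TrivSqZeroExt.fstHom k k k).toRingHom)))
    (hP : IsPullback iP f₀ f iQ) [Flat (f ≫ q)] [IsIso f₀] : IsIso f :=
  isIso_of_isIso_of_isPullback_specMap _ (dualNumber_fst_surjective k)
    ⟨2, dualNumber_ker_fst_sq_eq_bot k⟩ hQ hP

end SpecBase

end Literature.AlgebraicGeometry.Morphisms
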